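import Literature.MathematicalPhysics.QuantumFieldTheory.Balaban1983to89.Beta.TransferUV

/-!
# `Balaban1983to89.Beta.WindowLog` — β sub-cell row BETA-an5 (gen 2): the WINDOW LOGARITHM with its SHARP coefficient —
dyadic bookkeeping that turns a geometric rate for the dyadic shell sums of a marginal (`|w|⁻⁴`-type) lattice kernel into
`Σ_{0<‖w‖_∞≤M} f(w) = (I/log 2)·log M + O(1)` with an EXPLICIT `O(1)` (BETA-SPEC v1.8 §8.6 (L4): «window power counting …
dyadic-shell summation lemmas are kernel-able», owners an1/an5)

HONEST FRAMING (cell rule, verbatim): discharging `BetaPertH` makes Bałaban's UV stability UNCONDITIONAL — a real constructive-QFT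
result; it is NOT the continuum limit and NOT the Clay problem.  THIS MODULE DISCHARGES NOTHING of the series and asserts NOTHING of
Bałaban's papers: it is one-dimensional real bookkeeping over `Finset.range` / `Finset.Ico` plus the shell engine of `Beta.TransferUV`.
Value = the typed interface between (L4) (window power counting) and (L5) (the sign/value of the universal coefficient `b`, rows an3 +
num) of the ONE open statement (M2⁺) of the β sub-cell, NOT summit progress (audit cell `pub-balaban`, unit `b2b-balaban-beta-an5`
gen 2; prose `run/shared/lean/pub/pub-balaban/BETA/AN5.md` §4).

THE POINT.  In the one-step / large-`L` form (AF-0-L) of the target (BETA-SPEC §8.6; tree `Beta.LargeL.LogGrowthLower`: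
`β⁰_{k+1}(L) ≥ b·log L − A` for all `L ≥ 2`, all `k`), the logarithm is generated by the leading, degree-`−4`-homogeneous part `F` of the
Ward-reorganised one-loop integrand summed over the window `1 ≪ ‖w‖ ≪ L` of the fluctuation lattice `ℤ⁴` (§8.6 (b)(ii), (L4)).  The
two-sided `O(log M)` bounds for such kernels are in the tree (`TransferUV.abs_sum_le_of_quartic`, `log_le_sum_of_quartic`); what (L5)
needs is the SHARP form with an explicit, COMPUTABLE coefficient.  This file proves: if the dyadic shell sums
`S_j := Σ_{2^j < ‖w‖_∞ ≤ 2^{j+1}} f(w)` converge to a number `I` at a geometric rate, `|S_j − I| ≤ C·2^{−j}` (hypothesis SHAPE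
`DyadicRate`, see below for why it holds for homogeneous `F` and how num can certify `I`), and `f` obeys the marginal shellwise bound
`|f(w)| ≤ A/‖w‖_∞⁴`, then for EVERY `M ≥ 1`
  `|Σ_{0<‖w‖_∞≤M} f(w) − (I/log 2)·log M| ≤ 160·A + 2·C + |I|`          (`windowLog_sharp`).
So `b = I/log 2` with `I = lim_j S_j` — a limit of FINITE LATTICE SUMS with a proved tail rate: the object that certified interval
arithmetic can evaluate (BETA-SPEC §8.6 (L5): «certified interval arithmetic IS a proof here, because (L4) makes b an explicit finite
expression»).  For `F(w) = K(w/|w|)·|w|⁻⁴` with `K` Lipschitz on `S³` one has `I = ∫_{1<‖x‖_∞≤2} F dx = log 2 · ∫_{S³} K dσ`, i.e.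
`b = ∫_{S³} K dσ` — the continuum one-loop coefficient; the RATE `C·2^{−j}` is the Riemann-sum error of mesh `2^{−j}` for the
scale-invariant integral `∫_{1<‖x‖_∞≤2} F` (exact homogeneity `F(2^j v) = 2^{−4j}F(v)` makes `S_j` that Riemann sum), plus `O(2^{−j})`
boundary layers.  That derivation (hypothesis-free for such `F`) is NOT in this file: `DyadicRate` is carried as a HYPOTHESIS SHAPE,
asserted of nothing here (AN5.md §4, ledger row B14; two routes recorded there — cube-wise Riemann comparison with the summable
`|w|⁻⁵` error via `TransferUV.abs_sum_le_of_quintic`, or the discrete parent map `w ↦ sign(w)⌈|w|/2⌉` between consecutive shells).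
STATUS v1.1: the shape is DISCHARGED downstream, by the parent-map route, in `Beta.DyadicShell` (β lead strat-b12; imports this
file): `DyadicData h C → ∃ I, DyadicRate (shellSum h) I (576·C)` (`DyadicShell.dyadicRate`), with `windowLog`,
`windowLog_of_homogKernel(_perturbed)` (`F = K(x/|x|)|x|⁻⁴`-type continuum kernels plus an `O(|w|⁻⁵)` perturbation) and
`logGrowth_two_sided`; AN5.md row B14b is [kernel] accordingly.  Nothing in this file changed (v1.1 is docstring-only).

CITATION HEADER (lean-in-tree rule): no statement of the papers under audit is used.  Context pointers only: T. Bałaban, Commun. Math.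
Phys. **109** (1987) 249–301 [Balaban1987RG1], (1.22) p.264 (the object `β_{j+1}`), p.251 l.23 «where L is an odd, positive integer > 11,
and m is a positive integer» (DOCFIX v1.1, ref5 C-ref5-27: v1's «p.255/p.262 … sufficiently large» locators were not on those pages and are
withdrawn); G. F. Lawler, *Intersections of Random Walks* (1991) [Lawler1991] Thm 1.5.5, FIRST display — the gradient estimate
«∇_yG(x) − a_d|y|D_u(|x|^{2−d}) = O(|x|^{−d})», label (1.36) (held text chunk p0021 L55–L60 prints the theorem's two displays followed
by the labels (1.36), (1.37); only the first display is used here; DOCFIX G-beta-14 (i): v1's «(1.36)–(1.37)» suggested both were used)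
(the `|x|⁻⁴`-leading / `|x|⁻⁵`-error structure of two-derivative free bubbles; CITED-FACTS S-lit1-16).

CONTENTS (0 sorry): §1 dyadic blocks of a sequence (`dyadicBlock`, `sum_range_two_pow`); §2 the geometric-rate hypothesis `DyadicRate`
and `abs_sum_range_two_pow_sub_le` (`|Σ_{r<2^J} T_r − T_0 − J·I| ≤ 2C`); §3 general `M`: `Nat.log 2` bracketing, the partial top block
(`abs_sum_Ico_le_of_harmonic`), `abs_natLog_sub_log_div_log_le_one`, and `dyadic_sharp` for sequences; §4 the lattice statement
`windowLog_sharp` for `f : ℤ⁴ → ℝ` via `TransferUV.sum_annulus_zero_eq_sum_shells` / `card_annulus_succ_four_le`; §5 non-vacuity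
(`Witness`: the constant sequence, rate `C = 0`).
-/

namespace Literature.MathematicalPhysics.QuantumFieldTheory.Balaban1983to89.Beta.WindowLog

open Literature.MathematicalPhysics.QuantumFieldTheory.Balaban1983to89
open Literature.Probability.LatticeModels (box mem_box annulus mem_annulus)
open Beta.TransferUV
open Finset

/-! ## §1 — Dyadic blocks of a sequence -/

/-- The `j`-th dyadic block sum `Σ_{2^j ≤ r < 2^{j+1}} T r` (for shell sums `T r = Σ_{‖w‖_∞ = r+1} f`: the dyadic shell
`2^j < ‖w‖_∞ ≤ 2^{j+1}`). [folklore] -/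
def dyadicBlock (T : ℕ → ℝ) (j : ℕ) : ℝ := ∑ r ∈ Finset.Ico (2 ^ j) (2 ^ (j + 1)), T r

/-- `Σ_{r<2^J} T r = T 0 + Σ_{j<J} (j-th dyadic block)`. [folklore] -/
theorem sum_range_two_pow (T : ℕ → ℝ) (J : ℕ) :
    ∑ r ∈ Finset.range (2 ^ J), T r = T 0 + ∑ j ∈ Finset.range J, dyadicBlock T j := by
  induction J with
  | zero => simp
  | succ J ih =>
    rw [Finset.sum_range_succ, ← add_assoc, ← ih, dyadicBlock, Finset.range_eq_Ico, Finset.range_eq_Ico]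
    exact (Finset.sum_Ico_consecutive T (Nat.zero_le _) (Nat.pow_le_pow_right (by norm_num : 0 < 2) (Nat.le_succ J))).symm

/-! ## §2 — Geometric rate of the dyadic blocks ⇒ linear growth in `J` with bounded error -/

/-- **HYPOTHESIS SHAPE (L4-rate).**  The dyadic block sums converge to `I` at the geometric rate `C·2^{−j}`.  For the shell sums of
`F(w) = K(w/|w|)|w|⁻⁴`, `K` Lipschitz on the sphere, this holds with `I = ∫_{1<‖x‖_∞≤2} F dx = log 2·∫_{S³}K dσ` (Riemann sums of mesh
`2^{−j}` for a scale-invariant integral) — NOT derived here; asserted of nothing. [folklore] -/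
def DyadicRate (T : ℕ → ℝ) (I C : ℝ) : Prop :=
  ∀ j : ℕ, |dyadicBlock T j - I| ≤ C / 2 ^ j

/-- `Σ_{j<J} C/2^j = 2C − 2C/2^J`. [folklore] -/
theorem sum_range_div_two_pow (C : ℝ) (J : ℕ) :
    ∑ j ∈ Finset.range J, C / 2 ^ j = 2 * C - 2 * C / 2 ^ J := by
  induction J with
  | zero => simp
  | succ J ih =>
    rw [Finset.sum_range_succ, ih, pow_succ]
    field_simp
    ring

/-- `Σ_{j<J} C/2^j ≤ 2C` for `C ≥ 0`. [folklore] -/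
theorem sum_range_div_two_pow_le {C : ℝ} (hC : 0 ≤ C) (J : ℕ) : ∑ j ∈ Finset.range J, C / 2 ^ j ≤ 2 * C := by
  rw [sum_range_div_two_pow]
  have : 0 ≤ 2 * C / 2 ^ J := by positivity
  linarith

/-- **DYADIC RADII.**  Under `DyadicRate T I C`: `|Σ_{r<2^J} T r − T 0 − J·I| ≤ 2C`. [folklore] -/
theorem abs_sum_range_two_pow_sub_le {T : ℕ → ℝ} {I C : ℝ} (h : DyadicRate T I C) (hC : 0 ≤ C) (J : ℕ) :
    |∑ r ∈ Finset.range (2 ^ J), T r - T 0 - J * I| ≤ 2 * C := by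
  rw [sum_range_two_pow]
  have e : T 0 + ∑ j ∈ Finset.range J, dyadicBlock T j - T 0 - (J : ℝ) * I =
      ∑ j ∈ Finset.range J, (dyadicBlock T j - I) := by
    rw [Finset.sum_sub_distrib, Finset.sum_const, Finset.card_range, nsmul_eq_mul]
    ring
  rw [e]
  calc |∑ j ∈ Finset.range J, (dyadicBlock T j - I)| ≤ ∑ j ∈ Finset.range J, |dyadicBlock T j - I| :=
        Finset.abs_sum_le_sum_abs _ _
    _ ≤ ∑ j ∈ Finset.range J, C / 2 ^ j := Finset.sum_le_sum fun j _ => h j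
    _ ≤ 2 * C := sum_range_div_two_pow_le hC J

/-! ## §3 — General radius `M`: bracket `M` dyadically, bound the partial top block, compare `⌊log₂ M⌋` with `log M / log 2` -/

/-- **PARTIAL TOP BLOCK.**  If `|T r| ≤ B/(r+1)` (the marginal shellwise size: `#shell · A r⁻⁴ ≲ r⁻¹`) then any partial dyadic block is
`≤ B`: `|Σ_{2^J ≤ r < M} T r| ≤ B` for `M ≤ 2^{J+1}`. [folklore] -/
theorem abs_sum_Ico_le_of_harmonic {T : ℕ → ℝ} {B : ℝ} (hB : 0 ≤ B) (hT : ∀ r, |T r| ≤ B / ((r : ℝ) + 1)) {J M : ℕ}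
    (hM : M ≤ 2 ^ (J + 1)) : |∑ r ∈ Finset.Ico (2 ^ J) M, T r| ≤ B := by
  have hpow : (0 : ℝ) < (2 : ℝ) ^ J := by positivity
  have hterm : ∀ r ∈ Finset.Ico (2 ^ J) M, |T r| ≤ B / (2 : ℝ) ^ J := by
    intro r hr
    have hr' : 2 ^ J ≤ r := (Finset.mem_Ico.mp hr).1
    have hr2 : (2 : ℝ) ^ J ≤ (r : ℝ) + 1 := by
      have : ((2 ^ J : ℕ) : ℝ) ≤ (r : ℝ) := by exact_mod_cast hr'
      push_cast at this
      linarith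
    exact (hT r).trans (div_le_div_of_nonneg_left hB hpow hr2)
  have hcard : ((Finset.Ico (2 ^ J) M).card : ℝ) ≤ (2 : ℝ) ^ J := by
    rw [Nat.card_Ico]
    have : M - 2 ^ J ≤ 2 ^ J := by
      have := hM; rw [pow_succ] at this; omega
    exact_mod_cast this
  calc |∑ r ∈ Finset.Ico (2 ^ J) M, T r| ≤ ∑ r ∈ Finset.Ico (2 ^ J) M, |T r| := Finset.abs_sum_le_sum_abs _ _
    _ ≤ ∑ r ∈ Finset.Ico (2 ^ J) M, B / (2 : ℝ) ^ J := Finset.sum_le_sum hterm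
    _ = ((Finset.Ico (2 ^ J) M).card : ℝ) * (B / (2 : ℝ) ^ J) := by rw [Finset.sum_const, nsmul_eq_mul]
    _ ≤ (2 : ℝ) ^ J * (B / (2 : ℝ) ^ J) := mul_le_mul_of_nonneg_right hcard (by positivity)
    _ = B := by field_simp

/-- `⌊log₂ M⌋` is within `1` of `log M / log 2` (`M ≥ 1`). [folklore] -/
theorem abs_natLog_sub_log_div_log_le_one {M : ℕ} (hM : 1 ≤ M) :
    |((Nat.log 2 M : ℕ) : ℝ) - Real.log M / Real.log 2| ≤ 1 := by
  have hM0 : M ≠ 0 := by omega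
  have hMpos : (0 : ℝ) < M := by exact_mod_cast (show 0 < M by omega)
  have hlog2 : 0 < Real.log 2 := Real.log_pos (by norm_num)
  set J := Nat.log 2 M with hJ
  have h1 : 2 ^ J ≤ M := Nat.pow_log_le_self 2 hM0
  have h2 : M < 2 ^ (J + 1) := Nat.lt_pow_succ_log_self (by norm_num) M
  have h1' : (J : ℝ) * Real.log 2 ≤ Real.log M := by
    rw [← Real.log_pow]
    exact Real.log_le_log (by positivity) (by exact_mod_cast h1)
  have h2' : Real.log M ≤ ((J : ℝ) + 1) * Real.log 2 := by
    have e : ((J : ℝ) + 1) * Real.log 2 = Real.log ((2 : ℝ) ^ (J + 1)) := by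
      rw [Real.log_pow]; push_cast; ring
    rw [e]
    refine Real.log_le_log hMpos ?_
    have : ((M : ℕ) : ℝ) ≤ ((2 ^ (J + 1) : ℕ) : ℝ) := by exact_mod_cast h2.le
    push_cast at this
    exact this
  rw [abs_le]
  constructor
  · -- J - log M / log 2 ≥ -1  ⇐  log M ≤ (J+1) log 2
    have : Real.log M / Real.log 2 ≤ (J : ℝ) + 1 := by
      rw [div_le_iff₀ hlog2]; exact h2'
    linarith
  · have : (J : ℝ) ≤ Real.log M / Real.log 2 := by
      rw [le_div_iff₀ hlog2]; exact h1'
    linarith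

/-- **SHARP DYADIC ASYMPTOTICS FOR SEQUENCES.**  If `|T r| ≤ B/(r+1)` for all `r` and the dyadic blocks satisfy `DyadicRate T I C`, then
for every `M ≥ 1`: `|Σ_{r<M} T r − (I/log 2)·log M| ≤ 2B + 2C + |I|` (`|T 0| ≤ B`, partial top block `≤ B`, dyadic error `≤ 2C`,
`|⌊log₂M⌋ − log M/log 2|·|I| ≤ |I|`). [folklore] -/
theorem dyadic_sharp {T : ℕ → ℝ} {B I C : ℝ} (hB : 0 ≤ B) (hC : 0 ≤ C) (hT : ∀ r, |T r| ≤ B / ((r : ℝ) + 1))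
    (h : DyadicRate T I C) {M : ℕ} (hM : 1 ≤ M) :
    |∑ r ∈ Finset.range M, T r - I / Real.log 2 * Real.log M| ≤ 2 * B + 2 * C + |I| := by
  have hM0 : M ≠ 0 := by omega
  set J := Nat.log 2 M with hJ
  have h1 : 2 ^ J ≤ M := Nat.pow_log_le_self 2 hM0
  have h2 : M < 2 ^ (J + 1) := Nat.lt_pow_succ_log_self (by norm_num) M
  -- split the range at 2^J
  have hsplit : ∑ r ∈ Finset.range M, T r = ∑ r ∈ Finset.range (2 ^ J), T r + ∑ r ∈ Finset.Ico (2 ^ J) M, T r := by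
    rw [Finset.range_eq_Ico, Finset.range_eq_Ico]
    exact (Finset.sum_Ico_consecutive T (Nat.zero_le _) h1).symm
  have hdy := abs_sum_range_two_pow_sub_le h hC J
  have htop := abs_sum_Ico_le_of_harmonic hB hT h2.le
  have hT0 : |T 0| ≤ B := by simpa using hT 0
  have hlog := abs_natLog_sub_log_div_log_le_one hM
  rw [← hJ] at hlog
  have hI : |(J : ℝ) * I - I / Real.log 2 * Real.log M| ≤ |I| := by
    have e : (J : ℝ) * I - I / Real.log 2 * Real.log M = ((J : ℝ) - Real.log M / Real.log 2) * I := by ring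
    rw [e, abs_mul]
    calc |(J : ℝ) - Real.log M / Real.log 2| * |I| ≤ 1 * |I| := mul_le_mul_of_nonneg_right hlog (abs_nonneg I)
      _ = |I| := one_mul _
  -- assemble
  have e : ∑ r ∈ Finset.range M, T r - I / Real.log 2 * Real.log M =
      (∑ r ∈ Finset.range (2 ^ J), T r - T 0 - J * I) + ∑ r ∈ Finset.Ico (2 ^ J) M, T r + T 0 +
        ((J : ℝ) * I - I / Real.log 2 * Real.log M) := by rw [hsplit]; ring
  rw [e]
  calc |(∑ r ∈ Finset.range (2 ^ J), T r - T 0 - J * I) + ∑ r ∈ Finset.Ico (2 ^ J) M, T r + T 0 +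
          ((J : ℝ) * I - I / Real.log 2 * Real.log M)|
      ≤ |(∑ r ∈ Finset.range (2 ^ J), T r - T 0 - J * I) + ∑ r ∈ Finset.Ico (2 ^ J) M, T r + T 0| +
          |(J : ℝ) * I - I / Real.log 2 * Real.log M| := abs_add_le _ _
    _ ≤ (|(∑ r ∈ Finset.range (2 ^ J), T r - T 0 - J * I) + ∑ r ∈ Finset.Ico (2 ^ J) M, T r| + |T 0|) + |I| := by
          gcongr
          exact abs_add_le _ _
    _ ≤ ((|∑ r ∈ Finset.range (2 ^ J), T r - T 0 - J * I| + |∑ r ∈ Finset.Ico (2 ^ J) M, T r|) + |T 0|) + |I| := by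
          gcongr
          exact abs_add_le _ _
    _ ≤ ((2 * C + B) + B) + |I| := by gcongr
    _ = 2 * B + 2 * C + |I| := by ring

/-! ## §4 — The lattice statement in `d = 4` -/

/-- The shell sums of a lattice kernel: `T r = Σ_{‖w‖_∞ = r+1} f(w)` (`annulus 4 r (r+1)`). [folklore] -/
noncomputable def shellSum (f : (Fin 4 → ℤ) → ℝ) (r : ℕ) : ℝ := ∑ w ∈ annulus 4 r (r + 1), f w

/-- A marginal kernel (`|f(w)| ≤ A/‖w‖_∞⁴` shellwise) has shell sums `|T r| ≤ 80A/(r+1)` (`#shell ≤ 80(r+1)³`). [folklore] -/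
theorem abs_shellSum_le {f : (Fin 4 → ℤ) → ℝ} {A : ℝ} (hA : 0 ≤ A)
    (hf : ∀ r, ∀ w ∈ annulus 4 r (r + 1), |f w| ≤ A / ((r : ℝ) + 1) ^ 4) (r : ℕ) :
    |shellSum f r| ≤ 80 * A / ((r : ℝ) + 1) := by
  have hr : (0 : ℝ) < (r : ℝ) + 1 := by positivity
  rw [shellSum]
  calc |∑ w ∈ annulus 4 r (r + 1), f w| ≤ ∑ w ∈ annulus 4 r (r + 1), |f w| := Finset.abs_sum_le_sum_abs _ _
    _ ≤ ∑ w ∈ annulus 4 r (r + 1), A / ((r : ℝ) + 1) ^ 4 := Finset.sum_le_sum fun w hw => hf r w hw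
    _ = ((annulus 4 r (r + 1)).card : ℝ) * (A / ((r : ℝ) + 1) ^ 4) := by rw [Finset.sum_const, nsmul_eq_mul]
    _ ≤ 80 * ((r : ℝ) + 1) ^ 3 * (A / ((r : ℝ) + 1) ^ 4) :=
        mul_le_mul_of_nonneg_right (card_annulus_succ_four_le r) (by positivity)
    _ = 80 * A / ((r : ℝ) + 1) := by field_simp

/-- **THE WINDOW LOGARITHM, SHARP FORM (L4 ⇒ L5 interface).**  Let `f : ℤ⁴ → ℝ` satisfy the marginal shellwise bound
`|f(w)| ≤ A/‖w‖_∞⁴` and let its dyadic shell sums `S_j = Σ_{2^j<‖w‖_∞≤2^{j+1}} f(w)` satisfy `|S_j − I| ≤ C·2^{−j}`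
(`DyadicRate (shellSum f) I C`).  Then for every `M ≥ 1`:
`|Σ_{0<‖w‖_∞≤M} f(w) − (I/log 2)·log M| ≤ 160·A + 2·C + |I|`.
In the one-step picture (`M ~ L`): the window contributes `b·log L + O(1)` with `b = I/log 2` and an EXPLICIT `O(1)`; `I` is a limit of
finite lattice sums with a proved tail — computable by certified arithmetic. [folklore] -/
theorem windowLog_sharp {f : (Fin 4 → ℤ) → ℝ} {A I C : ℝ} (hA : 0 ≤ A) (hC : 0 ≤ C)
    (hf : ∀ r, ∀ w ∈ annulus 4 r (r + 1), |f w| ≤ A / ((r : ℝ) + 1) ^ 4) (h : DyadicRate (shellSum f) I C)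
    {M : ℕ} (hM : 1 ≤ M) :
    |∑ w ∈ annulus 4 0 M, f w - I / Real.log 2 * Real.log M| ≤ 160 * A + 2 * C + |I| := by
  have hshell : ∑ w ∈ annulus 4 0 M, f w = ∑ r ∈ Finset.range M, shellSum f r :=
    sum_annulus_zero_eq_sum_shells f M
  rw [hshell]
  have hT : ∀ r, |shellSum f r| ≤ 80 * A / ((r : ℝ) + 1) := abs_shellSum_le hA hf
  have := dyadic_sharp (B := 80 * A) (by positivity) hC hT h hM
  linarith [this]

/-- The dyadic shell sum written out: `dyadicBlock (shellSum f) j = Σ_{2^j < ‖w‖_∞ ≤ 2^{j+1}} f(w)` as a sum of `2^j` shells — the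
FINITE object num evaluates. [folklore] -/
theorem dyadicBlock_shellSum (f : (Fin 4 → ℤ) → ℝ) (j : ℕ) :
    dyadicBlock (shellSum f) j = ∑ r ∈ Finset.Ico (2 ^ j) (2 ^ (j + 1)), ∑ w ∈ annulus 4 r (r + 1), f w := rfl

/-! ## §5 — Non-vacuity -/

namespace Witness

/-- Degenerate instance: the zero sequence has `DyadicRate 0 0 0`. [folklore] -/
theorem dyadicRate_zero : DyadicRate (fun _ => 0) 0 0 := by
  intro j; simp [dyadicBlock]

/-- … and `dyadic_sharp` then reads `|Σ_{r<M} 0 − 0| ≤ 0` (the constants are not vacuous padding). [folklore] -/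
example {M : ℕ} (hM : 1 ≤ M) :
    |∑ r ∈ Finset.range M, (fun _ : ℕ => (0 : ℝ)) r - 0 / Real.log 2 * Real.log M| ≤ 2 * 0 + 2 * 0 + |(0 : ℝ)| :=
  dyadic_sharp (T := fun _ => 0) le_rfl le_rfl (fun r => by simp) dyadicRate_zero hM

/-- A witness separating `T 0` from the blocks: the sequence supported at `r = 0` (`T 0 = 1`, else `0`) has all dyadic blocks `0`
(blocks start at `r = 1`), so `DyadicRate T 0 0` while `Σ_{r<M} T = 1 = T 0` — the `T 0` / `|f|` on the innermost shell term in the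
constant of `dyadic_sharp` / `windowLog_sharp` is genuinely needed. [folklore] -/
theorem dyadicRate_delta : DyadicRate (fun r => if r = 0 then (1 : ℝ) else 0) 0 0 := by
  intro j
  rw [dyadicBlock, Finset.sum_eq_zero]
  · simp
  · intro r hr
    have : 2 ^ j ≤ r := (Finset.mem_Ico.mp hr).1
    have : r ≠ 0 := by have := Nat.one_le_two_pow (n := j); omega
    simp [this]

end Witness

end Literature.MathematicalPhysics.QuantumFieldTheory.Balaban1983to89.Beta.WindowLog
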